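import Summits.ABC.IUTFork.Repair.RHOffSigmaToleranceExponent
import Summits.ABC.ABC.Theorems.IUTThetaPilotThetaPartIIDegLe
import Summits.ABC.IUTFork.Conditional.AbcOfSigmaMassDisplay
import Summits.ABC.IUTFork.LDHGenuinePerImageSufficiencyNum
import Literature.NumberTheory.DiophantineGeometry.AbcExponentBoundOfPolynomialBound
import HarnessLib

/-!
# R-H ROUND 2, Q1 (cell/packet-strata rows 3/4/5; seat abc-iut-rh2-xi-1): the MULTIPLICATIVE abc-tolerance of the off-Σ remainder, V —
# THE EXPONENT CLASS, part 2 (the door): «Cor. 3.12 up to `B`» with a FIXED relative share `B ≤ κ·T.gap + Tol(P,l)`, `κ ∈ [0,1)`, at the genuine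
# Θ-data of the SZPIRO-BAD RATIONAL `(P, l)` ALONE ⟹ `c < C_ε·rad(abc)^{3/(1−κ)+ε}` for EVERY abc triple — CONE-FREE, window-free, `K_V`-free

PROOF-ONLY sequel (no `def`, no new `Prop`, no instance, no notation; nothing re-typed) of `RHOffSigmaToleranceExponent.lean` (this seat, part 1:
`abc_exp_of_dilatedDisplay_degOne` — the DILATED display `1/6 ↦ μ/6` at the rational points ⟹ exponent `3/μ + ε`), of this seat's `RHOffSigmaTolerance.lean`
(p469145: the kernel target `OffSigmaTolerance κ A T B := B ≤ κ·T.gap + A`, «Cor. 3.12 up to `B`» `T.negAbsLogQ − B ≤ T.negLogTheta`) and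
`RHOffSigmaToleranceMultAbc(Recut).lean` (p476573 / p478149: the `κ ≤ 1/(2l)` NO-LOSS certificates, cone-bound), of abc-iut-rh2-T-1's
`Conditional/AbcOfSigmaMassDisplay.lean` (p477154: `SigmaMass.dilatedDisplay_of_offSigmaTolerance`, regime (R2) «exponent dilated» — USED BY NAME as the
per-datum step), of abc-iut-S3/S1's degree-one hull theorem `ThetaPartIIDisplay.hullVolumeAtDatum_BIII_of_degree_le_one` and abc-iut-c312-d1's
`Cor22.cor312AtDatum_of_szpiro`. Rung LADDER-ABC:A2.RESCUE.H, R-H round 2 (director-abc g3 tranche 1 (7); ROUND2/READING.md v1.2 §Q2 «EXPONENT», §ANSWER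
«exponent factor `1/μ_r` ≤ 3.26 (frey bed) / 1.49 (HEX)»; START-HERE R3 pre-registered bins «`1/l < ρ < 1`: exponent `×1/(1−ρ)`»). TAKES NO SIDE on
[IUTchIII] Cor. 3.12 or on any author; typed ≠ proved; instantiated ≠ endorsed.

CONTENT.
* §1 `dilatedDisplay_degOne_of_offSigmaTolerance_szpiroBad` — AT DEGREE ONE THE HULL ESTIMATE IS A THEOREM (`d_mod = 1`, slot-constant, no Step-(v)
  residue, NO cone binder) and the Szpiro-good data carry print's undilated display as a THEOREM (`Cor22.cor312AtDatum_of_szpiro` +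
  `ThetaPartIIDisplay.display_of_squeezeIII`); so [NUMΣ-upTo]₁-bad «Cor. 3.12 up to `B(P,l,T)`» + [TOL-κ]₁-bad `OffSigmaTolerance κ Tol(P,l) T B`
  (`B ≤ κ·T.gap + ((l+1)/4)·5·d*·l`, `0 ≤ κ`) at the genuine Θ-data of the SZPIRO-BAD admissible rational `(P, l)` ALONE give the dilated display with
  `μ = 1 − κ` at EVERY admissible rational `(P, l)`;
* §2 **`abc_exp_of_offSigmaTolerance_szpiroBad_degOne`** (EXPLICIT 2 binders under the SAME guard, `0 ≤ κ < 1`) ⟹ `c < C_ε·rad(abc)^{3/(1−κ)+ε}` for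
  every abc triple; `log_le_of_offSigmaTolerance_szpiroBad_degOne` (log form, `0 < ε ≤ 1`); `abc_exp_of_offSigmaTolerance_degOne` (uncut binders —
  the shape of p476573's [NUMΣ-upTo]/[TOL-mult] restricted to degree one with the cone binder GONE); the READING's currency
  **`abc_exp_three_div_share_of_offBound_degOne`**: `B ≤ (1 − μ)·T.gap + Tol` (licensed share `μ ∈ (0,1]` of `M = T.gap`; abc-iut-rh2-w-1
  `RH.CellWeights` / abc-iut-rh2-T-1 `RH.SigmaMass`: `B_triv(Σᶜ) = (1 − μ_r)·M`) ⟹ exponent `3/μ + ε`.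
READING FOR THE BOARD (numbers, not adjectives): the pre-registered bin «`1/l < ρ < 1`: exponent `×1/(1−ρ)`» has a kernel endpoint at degree one —
a share `ρ ≤ κ` of `T.gap` (on top of `Tol`) at every Szpiro-bad rational datum yields abc with exponent `3/(1−κ) + ε`: `κ = 0.385` (abc-iut-rh-kit-2
PASS 18 FREY max `ρ₄`) ↦ `4.88 + ε`; `1/μ₄ ≤ 3.26` (frey bed) ↦ `9.8 + ε`; `1/μ₄ ≤ 1.49` (HEX) ↦ `4.5 + ε` — IF those shares held at every height, which no
table says (every tabulated datum is below Cor. 2.2 (ii)'s window; `l·ρ₄` rises with `l`); `κ = 0`: `3 + ε` (abc-iut-S6's polynomial abc under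
abc-iut-rh2-q2-cond's additive door `Tol`); `κ ≤ 1/(2l)` or Cor. 2.2 (ii)'s window: NO loss for `ABC` (p476573 / p473109) — a different, cone-bound road.
What is NOT here: the `1+ε ↦ (1+ε)/(1−κ)` endpoint for `ABC` itself (Cor. 2.2 (ii) at `d_mod > 1` + a [GenEll] Thm. 2.1 with a factor); any
`K`-budget (`+4K`: p474212 / T-1's `display_of_shortfall`, additive, exponent-free). HONEST SCOPE: CONDITIONAL on the two labelled binders; nothing
here asserts that abc (with any exponent) is proved or refuted, or that Cor. 3.12 (weakened or not) holds at any datum; no side taken; typed ≠ proved;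
computed ≠ proved; instantiated ≠ endorsed.
[cite: Mochizuki2012, IUTchIV Thm. 1.10 pp. 22–31; Cor. 2.2 (ii) pp. 41–48; Cor. 2.3 pp. 54–55] [cite: Mochizuki2012, IUTchIII Cor. 3.12 p. 173–174, Step (xi-f) p. 184]
[claim: Mochizuki2012, status: disputed]
Axioms: standard.
-/

noncomputable section

namespace Summit.ABC.IUTFork.Repair.RH.OffSigma

open Literature.IUT.LogVolume Literature.IUT.LogVolume.Cor22
open Literature.NumberTheory.DiophantineGeometry Literature.NumberTheory.DiophantineGeometry.GenEll
open Summit.ABC.ABC.Theorems Summit.ABC.IUTFork.Conditional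
open NumberField IsDedekindDomain Real

/-! ## §1 The dilated display at every admissible RATIONAL `(P, l)` from this seat's door at the Szpiro-bad ones (cone-free at degree one) -/

/-- **THE DILATED DISPLAY (`μ = 1 − κ`) AT EVERY ADMISSIBLE RATIONAL `(P, l)` from [NUMΣ-upTo]₁ + [TOL-κ]₁ at the SZPIRO-BAD ones** (`0 ≤ κ`):
at an admissible `(P, l)` of degree `1` a genuine datum exists (abc-iut-L5-t7 `ThetaPartII.stub_thetaData`), the hull estimate with `B_III(P,l)`
is a THEOREM (`ThetaPartIIDisplay.hullVolumeAtDatum_BIII_of_degree_le_one` — `d_mod = 1`, slot-constant, NO cone binder) and `l ≠ 5`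
(`ThetaPartII.seven_le_of_condP6`); if `(P, l)` is Szpiro-good, [IUTchIII] Cor. 3.12 at its Θ-data is abc-iut-c312-d1's THEOREM
`Cor22.cor312AtDatum_of_szpiro`, so print's undilated display holds (`ThetaPartIIDisplay.display_of_squeezeIII`) and a fortiori the dilated one
(`κ ≥ 0`, `log(q) ≥ 0`); if it is Szpiro-bad, «Cor. 3.12 up to `B`» and `OffSigmaTolerance κ Tol(P,l) T B` at the datum give the dilated
display by abc-iut-rh2-T-1's `SigmaMass.dilatedDisplay_of_offSigmaTolerance`. CONDITIONAL on the two binders; no side taken.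
[cite: Mochizuki2012, IUTchIV Thm. 1.10 Steps (ii)–(viii) pp. 24–31; Cor. 2.2 (ii) proof p. 46] [claim: Mochizuki2012, status: disputed] -/
theorem dilatedDisplay_degOne_of_offSigmaTolerance_szpiroBad {κ : ℝ} (hκ0 : 0 ≤ κ)
    (B : ∀ (P : NFPoint) (l : ℕ), ThetaVolumeDatumAt P l → ℝ)
    (h312B₁ : ∀ P : NFPoint, P ∈ UP → P.degree ≤ 1 → ∀ l : ℕ, l.Prime → 5 ≤ l →
      AdmitsCore P → CondP2 P l → CondP5 P l → CondP6 P l →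
      (((l : ℝ) + 5) / 4 < (dmod P : ℝ) ∨
        6 * l * (((l : ℝ) + 5) - 4 * dmod P) / (((l : ℝ) + 4) * ((l : ℝ) - 3))
            * (P.logDiff + (1 - 1 / (l : ℝ)) * logCondAvoid P {2, l})
          + 6 * l * ((l : ℝ) + 5) / (((l : ℝ) + 4) * ((l : ℝ) - 3)) * Real.log Real.pi < logQAvoid P {2, l}) →
      ∀ T : ThetaVolumeDatumAt P l, T.negAbsLogQ - B P l T ≤ T.negLogTheta)
    (hTol₁ : ∀ P : NFPoint, P ∈ UP → P.degree ≤ 1 → ∀ l : ℕ, l.Prime → 5 ≤ l →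
      AdmitsCore P → CondP2 P l → CondP5 P l → CondP6 P l →
      (((l : ℝ) + 5) / 4 < (dmod P : ℝ) ∨
        6 * l * (((l : ℝ) + 5) - 4 * dmod P) / (((l : ℝ) + 4) * ((l : ℝ) - 3))
            * (P.logDiff + (1 - 1 / (l : ℝ)) * logCondAvoid P {2, l})
          + 6 * l * ((l : ℝ) + 5) / (((l : ℝ) + 4) * ((l : ℝ) - 3)) * Real.log Real.pi < logQAvoid P {2, l}) →
      ∀ T : ThetaVolumeDatumAt P l,
        OffSigmaTolerance κ (((l : ℝ) + 1) / 4 * (5 * ((((2 ^ 12 * 3 ^ 3 * 5 * dmod P : ℕ) : ℝ)) * l))) T (B P l T)) :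
    ∀ η : ℝ, IsEtaPrm η → ∀ P : NFPoint, P ∈ UP → P.degree ≤ 1 → ∀ l : ℕ, l.Prime → 5 ≤ l →
      AdmitsCore P → CondP2 P l → CondP5 P l → CondP6 P l →
      1 / 6 * ((1 - κ) * logQAvoid P {2, l}) ≤
        (1 + 20 * (dmod P : ℝ) / l) * (P.logDiff + logCondAvoid P {2, l})
          + 20 * (2 ^ 12 * 3 ^ 3 * 5 * (dmod P : ℝ) * l + η) := by
  intro η hη P hP hdeg l hl h5 hcore hP2 hP5 h6
  have hU : P.InU := hP.1
  have h7 : 7 ≤ l := ThetaPartII.seven_le_of_condP6 hP hl h5 h6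
  have hne : l ≠ 5 := by omega
  have hvol := ThetaPartIIDisplay.hullVolumeAtDatum_BIII_of_degree_le_one hP hdeg hl h5 h6
  obtain ⟨T⟩ := ThetaPartII.stub_thetaData P hP l hl h5 hcore hP2 hP5 h6
  by_cases hd : (dmod P : ℝ) ≤ ((l : ℝ) + 5) / 4
  · by_cases hq : logQAvoid P {2, l} ≤
        6 * l * (((l : ℝ) + 5) - 4 * dmod P) / (((l : ℝ) + 4) * ((l : ℝ) - 3))
            * (P.logDiff + (1 - 1 / (l : ℝ)) * logCondAvoid P {2, l})
          + 6 * l * ((l : ℝ) + 5) / (((l : ℝ) + 4) * ((l : ℝ) - 3)) * Real.log Real.pi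
    · -- Szpiro-good: the undilated display is a theorem; weaken it by `κ ≥ 0`
      have hsq := Summit.ABC.IUTFork.PointDict.logQAvoid_le_of_cor312AtDatum (cor312AtDatum_of_szpiro hU h5 hd hq) hvol T hU
      have hD := ThetaPartIIDisplay.display_of_squeezeIII hl h5 hne hη hsq
      unfold Display at hD
      have hQ0 : 0 ≤ logQAvoid P {2, l} := logQAvoid_nonneg P {2, l}
      have hκQ : 0 ≤ κ * logQAvoid P {2, l} := mul_nonneg hκ0 hQ0
      calc 1 / 6 * ((1 - κ) * logQAvoid P {2, l}) = 1 / 6 * logQAvoid P {2, l} - 1 / 6 * (κ * logQAvoid P {2, l}) := by ring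
        _ ≤ 1 / 6 * logQAvoid P {2, l} := by linarith
        _ ≤ _ := hD
    · exact SigmaMass.dilatedDisplay_of_offSigmaTolerance hl h5 hne hη T hU
        (hTol₁ P hP hdeg l hl h5 hcore hP2 hP5 h6 (Or.inr (lt_of_not_ge hq)) T)
        (h312B₁ P hP hdeg l hl h5 hcore hP2 hP5 h6 (Or.inr (lt_of_not_ge hq)) T) (hvol T)
  · exact SigmaMass.dilatedDisplay_of_offSigmaTolerance hl h5 hne hη T hU
      (hTol₁ P hP hdeg l hl h5 hcore hP2 hP5 h6 (Or.inl (lt_of_not_ge hd)) T)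
      (h312B₁ P hP hdeg l hl h5 hcore hP2 hP5 h6 (Or.inl (lt_of_not_ge hd)) T) (hvol T)

/-! ## §2 The exponent-class endpoints -/

/-- **abc WITH EXPONENT `3/(1−κ) + ε` FROM «COR. 3.12 UP TO `B`» UNDER A FIXED RELATIVE TOLERANCE `κ ∈ [0,1)` AT THE SZPIRO-BAD RATIONAL DATA** —
[NUMΣ-upTo]₁-bad: at every genuine Θ-volume datum `T` of every Szpiro-bad admissible RATIONAL `(P, l)` a bound `B(P,l,T)` with
`T.negAbsLogQ − B ≤ T.negLogTheta` (what an `S_H|Σ` volume computation delivers: `B` = the off-Σ deficit / trivial `j²`-mass off the slice;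
ASSUMPTION LABEL), [TOL-κ]₁-bad: `B ≤ κ·T.gap + ((l+1)/4)·5·d*·l` (`OffSigmaTolerance κ Tol T B`, this seat's p469145 target) ⟹ for every
`ε > 0` some `C > 0` with `c < C·rad(abc)^{3/(1−κ)+ε}` for EVERY abc triple. EXPLICIT 2 binders, both under the SAME guard (`P ∈ U_P`,
`[F_tpd:ℚ] ≤ 1`, `l ≥ 5` prime, `AdmitsCore`, (P2), (P5), (P6), the Szpiro-bad disjunction of abc-iut-c312-d1 VERBATIM); NO cone binder (the
hull estimate at `d_mod = 1` is a theorem), NO window, NO `K_V`, NO `K`-budget. At `κ = 0` (with `B ≤ Tol`): exponent `3 + ε` (abc-iut-S6's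
polynomial abc under the additive door). This is the kernel form of the READING's «exponent factor `1/μ_r`» at degree one. CONDITIONAL;
nothing is asserted about the hypotheses; no side taken. [cite: Mochizuki2012, IUTchIV Cor. 2.2–2.3 pp. 41–55]
[cite: Mochizuki2012, IUTchIII Cor. 3.12 p. 173–174] [claim: Mochizuki2012, status: disputed] -/
theorem abc_exp_of_offSigmaTolerance_szpiroBad_degOne {κ : ℝ} (hκ0 : 0 ≤ κ) (hκ1 : κ < 1)
    (B : ∀ (P : NFPoint) (l : ℕ), ThetaVolumeDatumAt P l → ℝ)
    (h312B₁ : ∀ P : NFPoint, P ∈ UP → P.degree ≤ 1 → ∀ l : ℕ, l.Prime → 5 ≤ l →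
      AdmitsCore P → CondP2 P l → CondP5 P l → CondP6 P l →
      (((l : ℝ) + 5) / 4 < (dmod P : ℝ) ∨
        6 * l * (((l : ℝ) + 5) - 4 * dmod P) / (((l : ℝ) + 4) * ((l : ℝ) - 3))
            * (P.logDiff + (1 - 1 / (l : ℝ)) * logCondAvoid P {2, l})
          + 6 * l * ((l : ℝ) + 5) / (((l : ℝ) + 4) * ((l : ℝ) - 3)) * Real.log Real.pi < logQAvoid P {2, l}) →
      ∀ T : ThetaVolumeDatumAt P l, T.negAbsLogQ - B P l T ≤ T.negLogTheta)
    (hTol₁ : ∀ P : NFPoint, P ∈ UP → P.degree ≤ 1 → ∀ l : ℕ, l.Prime → 5 ≤ l →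
      AdmitsCore P → CondP2 P l → CondP5 P l → CondP6 P l →
      (((l : ℝ) + 5) / 4 < (dmod P : ℝ) ∨
        6 * l * (((l : ℝ) + 5) - 4 * dmod P) / (((l : ℝ) + 4) * ((l : ℝ) - 3))
            * (P.logDiff + (1 - 1 / (l : ℝ)) * logCondAvoid P {2, l})
          + 6 * l * ((l : ℝ) + 5) / (((l : ℝ) + 4) * ((l : ℝ) - 3)) * Real.log Real.pi < logQAvoid P {2, l}) →
      ∀ T : ThetaVolumeDatumAt P l,
        OffSigmaTolerance κ (((l : ℝ) + 1) / 4 * (5 * ((((2 ^ 12 * 3 ^ 3 * 5 * dmod P : ℕ) : ℝ)) * l))) T (B P l T))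
    {ε : ℝ} (hε : 0 < ε) :
    ∃ C : ℝ, 0 < C ∧ ∀ a b c : ℕ, IsABCTriple a b c →
      (c : ℝ) < C * ((rad a b c : ℕ) : ℝ) ^ (3 / (1 - κ) + ε) :=
  abc_exp_of_dilatedDisplay_degOne (μ := 1 - κ) (by linarith) (by linarith)
    (dilatedDisplay_degOne_of_offSigmaTolerance_szpiroBad hκ0 B h312B₁ hTol₁) hε

/-- **Log form**: under the same two binders, `log c ≤ (3/(1−κ))·(1+ε)·log rad(abc) + C_ε` for every `0 < ε ≤ 1` and every abc triple.
CONDITIONAL; no side taken. [cite: Mochizuki2012, IUTchIV Cor. 2.2 (ii) proof pp. 43–48] [claim: Mochizuki2012, status: disputed] -/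
theorem log_le_of_offSigmaTolerance_szpiroBad_degOne {κ : ℝ} (hκ0 : 0 ≤ κ) (hκ1 : κ < 1)
    (B : ∀ (P : NFPoint) (l : ℕ), ThetaVolumeDatumAt P l → ℝ)
    (h312B₁ : ∀ P : NFPoint, P ∈ UP → P.degree ≤ 1 → ∀ l : ℕ, l.Prime → 5 ≤ l →
      AdmitsCore P → CondP2 P l → CondP5 P l → CondP6 P l →
      (((l : ℝ) + 5) / 4 < (dmod P : ℝ) ∨
        6 * l * (((l : ℝ) + 5) - 4 * dmod P) / (((l : ℝ) + 4) * ((l : ℝ) - 3))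
            * (P.logDiff + (1 - 1 / (l : ℝ)) * logCondAvoid P {2, l})
          + 6 * l * ((l : ℝ) + 5) / (((l : ℝ) + 4) * ((l : ℝ) - 3)) * Real.log Real.pi < logQAvoid P {2, l}) →
      ∀ T : ThetaVolumeDatumAt P l, T.negAbsLogQ - B P l T ≤ T.negLogTheta)
    (hTol₁ : ∀ P : NFPoint, P ∈ UP → P.degree ≤ 1 → ∀ l : ℕ, l.Prime → 5 ≤ l →
      AdmitsCore P → CondP2 P l → CondP5 P l → CondP6 P l →
      (((l : ℝ) + 5) / 4 < (dmod P : ℝ) ∨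
        6 * l * (((l : ℝ) + 5) - 4 * dmod P) / (((l : ℝ) + 4) * ((l : ℝ) - 3))
            * (P.logDiff + (1 - 1 / (l : ℝ)) * logCondAvoid P {2, l})
          + 6 * l * ((l : ℝ) + 5) / (((l : ℝ) + 4) * ((l : ℝ) - 3)) * Real.log Real.pi < logQAvoid P {2, l}) →
      ∀ T : ThetaVolumeDatumAt P l,
        OffSigmaTolerance κ (((l : ℝ) + 1) / 4 * (5 * ((((2 ^ 12 * 3 ^ 3 * 5 * dmod P : ℕ) : ℝ)) * l))) T (B P l T))
    {ε : ℝ} (hε : 0 < ε) (hε1 : ε ≤ 1) :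
    ∃ C : ℝ, ∀ a b c : ℕ, IsABCTriple a b c →
      Real.log c ≤ 3 / (1 - κ) * (1 + ε) * Real.log (rad a b c) + C :=
  log_le_of_dilatedDisplay_degOne (μ := 1 - κ) (by linarith) (by linarith)
    (dilatedDisplay_degOne_of_offSigmaTolerance_szpiroBad hκ0 B h312B₁ hTol₁) hε hε1

/-- **Uncut binders** (the two hypotheses at EVERY admissible rational `(P, l)`, Szpiro-good or bad — the shape of this seat's p476573
`ABC_of_offSigmaToleranceMult_of_hullRegime` restricted to degree one, with the cone binder GONE): exponent `3/(1−κ) + ε`.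
CONDITIONAL; no side taken. [cite: Mochizuki2012, IUTchIV Cor. 2.2–2.3 pp. 41–55] [claim: Mochizuki2012, status: disputed] -/
theorem abc_exp_of_offSigmaTolerance_degOne {κ : ℝ} (hκ0 : 0 ≤ κ) (hκ1 : κ < 1)
    (B : ∀ (P : NFPoint) (l : ℕ), ThetaVolumeDatumAt P l → ℝ)
    (h312B₁ : ∀ P : NFPoint, P ∈ UP → P.degree ≤ 1 → ∀ l : ℕ, l.Prime → 5 ≤ l →
      AdmitsCore P → CondP2 P l → CondP5 P l → CondP6 P l →
      ∀ T : ThetaVolumeDatumAt P l, T.negAbsLogQ - B P l T ≤ T.negLogTheta)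
    (hTol₁ : ∀ P : NFPoint, P ∈ UP → P.degree ≤ 1 → ∀ l : ℕ, l.Prime → 5 ≤ l →
      AdmitsCore P → CondP2 P l → CondP5 P l → CondP6 P l →
      ∀ T : ThetaVolumeDatumAt P l,
        OffSigmaTolerance κ (((l : ℝ) + 1) / 4 * (5 * ((((2 ^ 12 * 3 ^ 3 * 5 * dmod P : ℕ) : ℝ)) * l))) T (B P l T))
    {ε : ℝ} (hε : 0 < ε) :
    ∃ C : ℝ, 0 < C ∧ ∀ a b c : ℕ, IsABCTriple a b c →
      (c : ℝ) < C * ((rad a b c : ℕ) : ℝ) ^ (3 / (1 - κ) + ε) :=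
  abc_exp_of_offSigmaTolerance_szpiroBad_degOne hκ0 hκ1 B
    (fun P hP hdeg l hl h5 hcore hP2 hP5 h6 _ => h312B₁ P hP hdeg l hl h5 hcore hP2 hP5 h6)
    (fun P hP hdeg l hl h5 hcore hP2 hP5 h6 _ => hTol₁ P hP hdeg l hl h5 hcore hP2 hP5 h6) hε

/-- **THE READING'S CURRENCY (licensed share `μ`)**: if at every genuine Θ-volume datum of every Szpiro-bad admissible rational `(P, l)` the off-Σ
bound satisfies `B(P,l,T) ≤ (1 − μ)·T.gap + ((l+1)/4)·5·d*·l` — the trivial `j²`-mass off a slice of licensed share `≥ μ ∈ (0,1]` of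
`M = T.gap` (abc-iut-rh2-w-1 `RH.CellWeights`, abc-iut-rh2-T-1 `RH.SigmaMass`: `B_triv(Σᶜ) = (1 − μ_r)·M`), plus the additive `Tol` — and
«Cor. 3.12 up to `B`» holds there, then `c < C_ε·rad(abc)^{3/μ+ε}` for every abc triple: the «exponent factor `1/μ_r`» of ROUND2/READING.md as a
kernel theorem at degree one (`K_V`-free reading: base exponent `3`). CONDITIONAL; nothing asserted; no side taken.
[cite: Mochizuki2012, IUTchIV Cor. 2.2–2.3 pp. 41–55] [cite: Mochizuki2012, IUTchIII Cor. 3.12 p. 173–174] [claim: Mochizuki2012, status: disputed] -/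
theorem abc_exp_three_div_share_of_offBound_degOne {μ : ℝ} (hμ0 : 0 < μ) (hμ1 : μ ≤ 1)
    (B : ∀ (P : NFPoint) (l : ℕ), ThetaVolumeDatumAt P l → ℝ)
    (h312B₁ : ∀ P : NFPoint, P ∈ UP → P.degree ≤ 1 → ∀ l : ℕ, l.Prime → 5 ≤ l →
      AdmitsCore P → CondP2 P l → CondP5 P l → CondP6 P l →
      (((l : ℝ) + 5) / 4 < (dmod P : ℝ) ∨
        6 * l * (((l : ℝ) + 5) - 4 * dmod P) / (((l : ℝ) + 4) * ((l : ℝ) - 3))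
            * (P.logDiff + (1 - 1 / (l : ℝ)) * logCondAvoid P {2, l})
          + 6 * l * ((l : ℝ) + 5) / (((l : ℝ) + 4) * ((l : ℝ) - 3)) * Real.log Real.pi < logQAvoid P {2, l}) →
      ∀ T : ThetaVolumeDatumAt P l, T.negAbsLogQ - B P l T ≤ T.negLogTheta)
    (hShare₁ : ∀ P : NFPoint, P ∈ UP → P.degree ≤ 1 → ∀ l : ℕ, l.Prime → 5 ≤ l →
      AdmitsCore P → CondP2 P l → CondP5 P l → CondP6 P l →
      (((l : ℝ) + 5) / 4 < (dmod P : ℝ) ∨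
        6 * l * (((l : ℝ) + 5) - 4 * dmod P) / (((l : ℝ) + 4) * ((l : ℝ) - 3))
            * (P.logDiff + (1 - 1 / (l : ℝ)) * logCondAvoid P {2, l})
          + 6 * l * ((l : ℝ) + 5) / (((l : ℝ) + 4) * ((l : ℝ) - 3)) * Real.log Real.pi < logQAvoid P {2, l}) →
      ∀ T : ThetaVolumeDatumAt P l,
        B P l T ≤ (1 - μ) * T.gap + ((l : ℝ) + 1) / 4 * (5 * ((((2 ^ 12 * 3 ^ 3 * 5 * dmod P : ℕ) : ℝ)) * l)))
    {ε : ℝ} (hε : 0 < ε) :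
    ∃ C : ℝ, 0 < C ∧ ∀ a b c : ℕ, IsABCTriple a b c →
      (c : ℝ) < C * ((rad a b c : ℕ) : ℝ) ^ (3 / μ + ε) := by
  have e : 3 / μ = 3 / (1 - (1 - μ)) := by rw [sub_sub_cancel]
  rw [e]
  exact abc_exp_of_offSigmaTolerance_szpiroBad_degOne (κ := 1 - μ) (by linarith) (by linarith) B h312B₁
    (fun P hP hdeg l hl h5 hcore hP2 hP5 h6 hbad T => hShare₁ P hP hdeg l hl h5 hcore hP2 hP5 h6 hbad T) hε

/-! ## §3 (v2 append, 2026-08-27) The same endpoints in Lagarias–Soundararajan's `κ₁`-parametrisation `ABCExponentBound κ₁`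
(Literature `XYZConjectureABCExponent`: «for every `ε > 0` only finitely many abc triples have `rad(abc) ≤ c^{κ₁−ε}`»; `κ₁ = 1` is abc itself,
`κ₁ > 1` is false) — via the PROVED dictionary `abcExponentBound_inv_of_forall_exists_const` (`c < C_ε·rad^{e+ε}` ∀ε ⟹ `ABCExponentBound (1/e)`) -/

/-- **The DILATED display at the rational points (`0 < μ ≤ 1`) ⟹ `ABCExponentBound (μ/3)`** (part 1's `abc_exp_of_dilatedDisplay_degOne`, exponent
`e = 3/μ`, recorded as `κ₁ = 1/e = μ/3`). CONDITIONAL on the display binder; no side taken. [cite: Mochizuki2012, IUTchIV Cor. 2.2 (ii) pp. 41–48]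
[cite: LagariasSoundararajan2011, §1] [claim: Mochizuki2012, status: disputed] -/
theorem abcExponentBound_of_dilatedDisplay_degOne {μ : ℝ} (hμ0 : 0 < μ) (hμ1 : μ ≤ 1)
    (hdisp : ∀ η : ℝ, IsEtaPrm η → ∀ P : NFPoint, P ∈ UP → P.degree ≤ 1 → ∀ l : ℕ, l.Prime → 5 ≤ l →
      AdmitsCore P → CondP2 P l → CondP5 P l → CondP6 P l →
      1 / 6 * (μ * logQAvoid P {2, l}) ≤
        (1 + 20 * (dmod P : ℝ) / l) * (P.logDiff + logCondAvoid P {2, l})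
          + 20 * (2 ^ 12 * 3 ^ 3 * 5 * (dmod P : ℝ) * l + η)) :
    ABCExponentBound (μ / 3) := by
  rw [show μ / 3 = 1 / (3 / μ) by rw [one_div_div]]
  exact abcExponentBound_inv_of_forall_exists_const (by positivity)
    (fun ε hε => abc_exp_of_dilatedDisplay_degOne hμ0 hμ1 hdisp hε)

/-- **«COR. 3.12 UP TO `B`» WITH A FIXED RELATIVE SHARE `κ ∈ [0,1)` AT THE SZPIRO-BAD RATIONAL DATA ⟹ `ABCExponentBound ((1−κ)/3)`** — the weak abc
conjecture in Lagarias–Soundararajan's parametrisation with `κ₁ = (1−κ)/3`, from the two binders of `abc_exp_of_offSigmaTolerance_szpiroBad_degOne`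
([NUMΣ-upTo]₁-bad, [TOL-κ]₁-bad; cone-free, window-free, `K_V`-free). `κ = 0` ↦ `κ₁ = 1/3`; `κ = 0.385` ↦ `κ₁ = 0.205`. CONDITIONAL; nothing is asserted
about the hypotheses; no side taken. [cite: Mochizuki2012, IUTchIV Cor. 2.2–2.3 pp. 41–55] [cite: LagariasSoundararajan2011, §1]
[claim: Mochizuki2012, status: disputed] -/
theorem abcExponentBound_of_offSigmaTolerance_szpiroBad_degOne {κ : ℝ} (hκ0 : 0 ≤ κ) (hκ1 : κ < 1)
    (B : ∀ (P : NFPoint) (l : ℕ), ThetaVolumeDatumAt P l → ℝ)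
    (h312B₁ : ∀ P : NFPoint, P ∈ UP → P.degree ≤ 1 → ∀ l : ℕ, l.Prime → 5 ≤ l →
      AdmitsCore P → CondP2 P l → CondP5 P l → CondP6 P l →
      (((l : ℝ) + 5) / 4 < (dmod P : ℝ) ∨
        6 * l * (((l : ℝ) + 5) - 4 * dmod P) / (((l : ℝ) + 4) * ((l : ℝ) - 3))
            * (P.logDiff + (1 - 1 / (l : ℝ)) * logCondAvoid P {2, l})
          + 6 * l * ((l : ℝ) + 5) / (((l : ℝ) + 4) * ((l : ℝ) - 3)) * Real.log Real.pi < logQAvoid P {2, l}) →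
      ∀ T : ThetaVolumeDatumAt P l, T.negAbsLogQ - B P l T ≤ T.negLogTheta)
    (hTol₁ : ∀ P : NFPoint, P ∈ UP → P.degree ≤ 1 → ∀ l : ℕ, l.Prime → 5 ≤ l →
      AdmitsCore P → CondP2 P l → CondP5 P l → CondP6 P l →
      (((l : ℝ) + 5) / 4 < (dmod P : ℝ) ∨
        6 * l * (((l : ℝ) + 5) - 4 * dmod P) / (((l : ℝ) + 4) * ((l : ℝ) - 3))
            * (P.logDiff + (1 - 1 / (l : ℝ)) * logCondAvoid P {2, l})
          + 6 * l * ((l : ℝ) + 5) / (((l : ℝ) + 4) * ((l : ℝ) - 3)) * Real.log Real.pi < logQAvoid P {2, l}) →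
      ∀ T : ThetaVolumeDatumAt P l,
        OffSigmaTolerance κ (((l : ℝ) + 1) / 4 * (5 * ((((2 ^ 12 * 3 ^ 3 * 5 * dmod P : ℕ) : ℝ)) * l))) T (B P l T)) :
    ABCExponentBound ((1 - κ) / 3) :=
  abcExponentBound_of_dilatedDisplay_degOne (μ := 1 - κ) (by linarith) (by linarith)
    (dilatedDisplay_degOne_of_offSigmaTolerance_szpiroBad hκ0 B h312B₁ hTol₁)

/-- **THE READING'S CURRENCY**: off-Σ bound `B ≤ (1 − μ)·T.gap + Tol(P,l)` (licensed share `μ ∈ (0,1]` of `M = T.gap`) together with «Cor. 3.12 up to `B`»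
at the genuine Θ-data of the Szpiro-bad admissible rational `(P, l)` ⟹ `ABCExponentBound (μ/3)` — the «exponent factor `1/μ_r`» of ROUND2/READING.md
as the weak abc conjecture with `κ₁ = μ/3` (`K_V`-free degree-one reading: base `κ₁ = 1/3` at `μ = 1`). CONDITIONAL; nothing asserted; no side taken.
[cite: Mochizuki2012, IUTchIV Cor. 2.2–2.3 pp. 41–55] [cite: LagariasSoundararajan2011, §1] [claim: Mochizuki2012, status: disputed] -/
theorem abcExponentBound_share_of_offBound_degOne {μ : ℝ} (hμ0 : 0 < μ) (hμ1 : μ ≤ 1)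
    (B : ∀ (P : NFPoint) (l : ℕ), ThetaVolumeDatumAt P l → ℝ)
    (h312B₁ : ∀ P : NFPoint, P ∈ UP → P.degree ≤ 1 → ∀ l : ℕ, l.Prime → 5 ≤ l →
      AdmitsCore P → CondP2 P l → CondP5 P l → CondP6 P l →
      (((l : ℝ) + 5) / 4 < (dmod P : ℝ) ∨
        6 * l * (((l : ℝ) + 5) - 4 * dmod P) / (((l : ℝ) + 4) * ((l : ℝ) - 3))
            * (P.logDiff + (1 - 1 / (l : ℝ)) * logCondAvoid P {2, l})
          + 6 * l * ((l : ℝ) + 5) / (((l : ℝ) + 4) * ((l : ℝ) - 3)) * Real.log Real.pi < logQAvoid P {2, l}) →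
      ∀ T : ThetaVolumeDatumAt P l, T.negAbsLogQ - B P l T ≤ T.negLogTheta)
    (hShare₁ : ∀ P : NFPoint, P ∈ UP → P.degree ≤ 1 → ∀ l : ℕ, l.Prime → 5 ≤ l →
      AdmitsCore P → CondP2 P l → CondP5 P l → CondP6 P l →
      (((l : ℝ) + 5) / 4 < (dmod P : ℝ) ∨
        6 * l * (((l : ℝ) + 5) - 4 * dmod P) / (((l : ℝ) + 4) * ((l : ℝ) - 3))
            * (P.logDiff + (1 - 1 / (l : ℝ)) * logCondAvoid P {2, l})
          + 6 * l * ((l : ℝ) + 5) / (((l : ℝ) + 4) * ((l : ℝ) - 3)) * Real.log Real.pi < logQAvoid P {2, l}) →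
      ∀ T : ThetaVolumeDatumAt P l,
        B P l T ≤ (1 - μ) * T.gap + ((l : ℝ) + 1) / 4 * (5 * ((((2 ^ 12 * 3 ^ 3 * 5 * dmod P : ℕ) : ℝ)) * l)))
    : ABCExponentBound (μ / 3) := by
  rw [show μ / 3 = 1 / (3 / μ) by rw [one_div_div]]
  exact abcExponentBound_inv_of_forall_exists_const (by positivity)
    (fun ε hε => abc_exp_three_div_share_of_offBound_degOne hμ0 hμ1 B h312B₁ hShare₁ hε)

end Summit.ABC.IUTFork.Repair.RH.OffSigma

end
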